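import Literature.MathematicalPhysics.QuantumFieldTheory.Balaban1983to89.B1Eq211ZeroFieldTorusLevels
import Literature.MathematicalPhysics.QuantumFieldTheory.Balaban1983to89.B1Ineq225ZeroFieldTorus
import Literature.MathematicalPhysics.QuantumFieldTheory.Balaban1983to89.B1Ineq234Concrete

/-!
# `Balaban1983to89.B1Eq220ZeroFieldTorusLevels` — T. Bałaban, *(Higgs)₂,₃ quantum fields in a finite volume. I. A lower bound*,
# Commun. Math. Phys. **85** (1982) 603–626 [Balaban1982Higgs1]: AT EVERY LEVEL `1 ≦ k ≦ K` AND FOR EVERY COUPLING, the propagator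
# (2.20) `G^ε_k(T_ε, 0) = (−Δ^{ε,N}_0 + m² + a_k(L^kε)^{−2}P_k(0))^{−1}` of the (Higgs)₂,₃ model on `ℝ^N`-valued fields IS `(L^kε)²·G_k`
# of Bałaban's scalar torus tower (`B1RG242Torus`) with TOP level `k` — the rescaling (2.22) at level `k` — componentwise; and the
# torus distance (1.3) of the model IS the sup torus distance of the `Setup` lineage (`B5Ineq137Torus.T`) under the identification

statement-level skeleton of published theorems with citation tags; proofs where landed; nothing here is a claim about the Yang–Mills mass gap

PDF held: `paper:balaban1982-cmp85-higgs23-i` (journal page = PDF page + 602); p. 604 [PDF 2] ((1.3)–(1.5)), p. 605 [PDF 3] ((1.11)),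
p. 609–610 [PDF 7–8] ((2.11), (2.17), (2.20), (2.22)); ×2 renders
`run/shared/lean/pub/pub-balaban/b2b-balaban-ref1/pages/1982-cmp85-higgs23-I/1982-cmp85-higgs23-I-p002|p003|p007|p008-x2.png`.

CITATION HEADER (lean-in-tree rule).  Cell `lit-balaban` (HOME `run/shared/lean/pub/lit-balaban/`), Phase-2 proof seat **p14** gen 9
(unit `lit-balaban-p14`); KNITTING for SKELETON rows **B1.Eq1.3**, **B1.Eq2.10–2.11**, **B1.Eq2.17**, **B1.Eq2.20**, **B1.Eq2.22** (r14/r01)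
and the level-`k` inputs of **B1.Eq3.53** / **B1.Eq3.66–3.67** (r12), **B1.Prop2.1**, **B1.Prop2.3** (file 3 `B1Ineq225ZeroFieldTorusLevels`).
File 2 of three.  USED BY NAME, never restated: this seat's `B1Eq211ZeroFieldTorusLevels` (file 1: `setupAt`, `eSiteAt`, `cmpAt`, `liftAt`,
§3 charge-invisibility), gen 8's `B1Eq211ZeroFieldTorus.{Shape, hOp_mulVec_apply}` and `B1Ineq225ZeroFieldTorus.{opS_mul_G, G_mul_opS}`;
the typer's `HiggsLattice` ((1.3) `Site.tdist`), `HiggsAveraging`, `HiggsCovariance`; `B3MultiscaleFields.{zeroCharge, zeroCharge_U}`;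
`B1Eq31Concrete.covLaplacianN_univ_apply`; r14's `B1Ineq234Concrete.circAbs_val_sub`; pv07/p38's `Setup`, `B1RG242Torus`, `B5Ineq137Torus.T`.

WHAT IS PRINTED (verbatim).  p. 604 [PDF 2], (1.3): *"|x − y| = max_μ min{|x_μ − y_μ|, 2L_μ − |x_μ − y_μ|}"*; p. 609 [PDF 7], (2.11):
*"(Q_k(A)f)(y) = L^{−kd}Σ_{x∈B^k(y)} U(A(Γ^{(k)}_{y,x}))f(x)"*; p. 605 [PDF 3]: *"−Δ^ε_A = D^{ε*}_AD^ε_A is the covariant Laplace operator"*;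
p. 610 [PDF 8], (2.20): *"G^ε_k(Ω,A) = (−Δ^{ε,N}_{A,Ω} + m² + a_k(L^kε)^{−2}P_k(A))^{−1}, P_k(A) = Q^*_k(A)Q_k(A)"*; (2.22): *"Let us rescale the
operators (2.20), (2.21) from ε-lattice to L^{−k}-lattice … G_k(Ω,A) = (−Δ^{η,N}_{A,Ω} + m²(L^kε)² + a_kP_k(A))^{−1}, η = L^{−k}. This operator
can be treated as defined on the unit lattice because L^kη = 1"*.

WHAT THIS FILE PROVES (kernel-checked, zero `sorry`, theorems only; axioms standard).
* §4 the level-`k` dictionaries (`j ≦ k ≦ K`, `ℝ^N`-valued fields, trivial coupling — = every coupling by file 1 §3):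
  `covLaplacianN_zero_apply_at` ((1.11)/(2.17)), `avgQkLin_zero_apply_at` ((2.11) IS `Setup`'s `Q_j`), `avgQkAdj_zero_apply_at`,
  `projPk_zero_apply_at`, **`covOpK_zero_apply_at`** / `cmpAt_covOpK`: `cmp_i((−Δ^ε + m² + a_k(L^kε)^{−2}P_k)φ) = ℓ^{−2}·(H_S(m²ℓ²) +
  a_kQ^*_kQ_k)cmp_iφ`, `ℓ = L^kε`, `H_S(m²ℓ²) = −Δ^{η} + m²ℓ²` on `setupAt S k`.
* §5 **(2.20) AT LEVEL `k` = `(L^kε)²·`(2.22)**: `covOpK_mul_liftAt`, `liftAt_mul_covOpK` (two-sided inverse), `isUnit_covOpK_zero_at`,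
  **`propagatorK_zero_eq_at`** (`propagatorK C T_ε 0 m² a k = ℓ²·liftAt((tower (setupAt S k) a (m²ℓ²)).G k)`, every `C`, `1 ≦ k ≦ K`,
  `a > 0`, `m² ≧ 0`), `propagatorK_zero_apply_at`, `cmpAt_propagatorK`.
* §6 **(1.3) IS the `Setup` lineage's sup torus distance**: `T_eSiteAt` — `T (setupAt S k) j (e x) (e z) = tdist x z` (lattice units of
  `T^{(j)}`), the dictionary for the decay exponents `dist(x, supp f)` of (2.25) and `dist(supp f, supp f′)` of [B4] Cor. 2.3.
HONEST SCOPE: zero external field (hence any coupling), whole torus `Ω = T_ε`, the sub-family `M·L′_μ = L^m`, `L` odd; levels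
`1 ≦ k ≦ K` for the propagator (`k = 0` is not a tower level).  Nothing quantitative here (file 3).  Unit `lit-balaban-p14` gen 9
(literature-prover-lit-balaban-p14-g9-0).
-/

open scoped BigOperators
open Matrix

namespace Literature.MathematicalPhysics.QuantumFieldTheory.Balaban1983to89.B1Eq220ZeroFieldTorusLevels

open Literature.MathematicalPhysics.QuantumFieldTheory.Balaban1983to89.HiggsLattice (ChargeData)
open Literature.MathematicalPhysics.QuantumFieldTheory.Balaban1983to89.HiggsAveraging (blockIter blockK mem_blockK avgQk_apply)
open Literature.MathematicalPhysics.QuantumFieldTheory.Balaban1983to89.HiggsCovariance (covLaplacianN avgQkLin avgQkAdj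
  projPk covOpK propagatorK avgQkLin_apply)
open Literature.MathematicalPhysics.QuantumFieldTheory.Balaban1983to89.B3MultiscaleFields (zeroCharge zeroCharge_U)
open Literature.MathematicalPhysics.QuantumFieldTheory.Balaban1983to89.B1Eq31Concrete (covLaplacianN_univ_apply)
open Literature.MathematicalPhysics.QuantumFieldTheory.Balaban1983to89.B1RG242Torus (tower Qk Qks H hOp α Qk_mulVec Qks_mulVec G_arg)
open Literature.MathematicalPhysics.QuantumFieldTheory.Balaban1983to89.B1Eq211ZeroFieldTorus (Shape hOp_mulVec_apply)
open Literature.MathematicalPhysics.QuantumFieldTheory.Balaban1983to89.B1Ineq225ZeroFieldTorus (opS_mul_G G_mul_opS)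
open Literature.MathematicalPhysics.QuantumFieldTheory.Balaban1983to89.B1Eq211ZeroFieldTorusLevels (setupAt setupAt_L setupAt_d
  sitesPerDir_eq_at mesh_zero_eq_at spacing_top le_range_at eSiteAt val_eSiteAt eSiteAt_blockIter sum_blockK_eq_at cmpAt cmpAt_apply
  cmpAt_apply_eSiteAt cmpAt_shift cmpAt_unshift eq_of_cmpAt_eq liftAt liftAt_apply cmpAt_liftAt covOpK_charge_zeroField)
open Literature.MathematicalPhysics.QuantumFieldTheory.Balaban1983to89.B5Ineq137Torus (T)
open Literature.MathematicalPhysics.QuantumFieldTheory.Balaban1983to89.B1Ineq234Concrete (circAbs_val_sub)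

variable {P : HiggsLattice.Params}
/-! ## §4 The level-`k` dictionaries: (2.11), `Q_k^*`, `P_k`, (1.11)/(2.17) and the operator of (2.20), `ℝ^N`-valued fields -/

section Dictionary

variable (S : Shape P) {k : ℕ} (hk : k ≤ P.K) {N : ℕ}

/-- **(1.11)/(2.17) at zero field IS `Setup`'s `−Δ`** on the level-`k` torus: the `i`-th component of `(−Δ^ε φ)(x)` (trivial coupling,
`A = 0`, whole torus) is `ε^{−2}Σ_μ[(φ_i(x) − φ_i(x+εe_μ)) + (φ_i(x) − φ_i(x−εe_μ))]` read through `cmpAt`. [cite: Balaban1982Higgs1, (2.17) p.610] -/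
theorem covLaplacianN_zero_apply_at (φ : HiggsLattice.ScalarField P 0 N) (x : HiggsLattice.Site P 0) (i : Fin N) :
    (covLaplacianN (zeroCharge N) Finset.univ (0 : HiggsLattice.VecField P 0) φ x) i
      = ((P.mesh 0)⁻¹) ^ 2 * ∑ μ : Fin P.d,
          ((cmpAt S hk i φ (eSiteAt S hk (Nat.zero_le _) x) - cmpAt S hk i φ ((eSiteAt S hk (Nat.zero_le _) x).shift μ))
            + (cmpAt S hk i φ (eSiteAt S hk (Nat.zero_le _) x) - cmpAt S hk i φ ((eSiteAt S hk (Nat.zero_le _) x).unshift μ))) := by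
  rw [covLaplacianN_univ_apply]
  simp only [zeroCharge_U, one_apply_eq_self, PiLp.smul_apply, smul_eq_mul, WithLp.ofLp_sum,
    Finset.sum_apply, WithLp.ofLp_add, WithLp.ofLp_sub, Pi.add_apply, Pi.sub_apply, cmpAt_apply_eSiteAt, cmpAt_shift,
    cmpAt_unshift]

/-- **(2.11) at zero field IS `Setup`'s `Q_j`** on the level-`k` torus (`j ≦ k`): `(Q_jf)(y)_i = L^{−jd}Σ_{x∈B^j(y)}f_i(x) = (Q_j cmp_i f)(e y)`.
[cite: Balaban1982Higgs1, (2.11) p.609] -/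
theorem avgQkLin_zero_apply_at (a msq : ℝ) {j : ℕ} (hj : j ≤ k) (f : HiggsLattice.ScalarField P 0 N)
    (y : HiggsLattice.Site P j) (i : Fin N) :
    (avgQkLin (zeroCharge N) (0 : HiggsLattice.VecField P 0) j f y) i
      = ((tower (setupAt S k) a msq).Qk j *ᵥ cmpAt S hk i f) (eSiteAt S hk hj y) := by
  rw [avgQkLin_apply, avgQk_apply, Qk_mulVec a msq (le_range_at S k hj)]
  simp only [zeroCharge_U, one_apply_eq_self, PiLp.smul_apply, smul_eq_mul, WithLp.ofLp_sum,
    Finset.sum_apply]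
  rw [sum_blockK_eq_at S hk hj y (fun x => (f x) i)]
  simp only [cmpAt_apply, setupAt_L, setupAt_d]
  congr 1
  rw [inv_pow, ← pow_mul, mul_comm P.d j]

/-- **`Q_j^*` at zero field IS `Setup`'s `Q^*_j`** on the level-`k` torus (`j ≦ k`): `(Q_j^*g)(x)_i = g_i(x_j) = (Q^*_j g̃_i)(e x)`.
[cite: Balaban1982Higgs1, (2.20) p.610] -/
theorem avgQkAdj_zero_apply_at (a msq : ℝ) {j : ℕ} (hj : j ≤ k) (g : HiggsLattice.ScalarField P j N)
    (x : HiggsLattice.Site P 0) (i : Fin N) :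
    (avgQkAdj (zeroCharge N) (0 : HiggsLattice.VecField P 0) j g x) i
      = ((tower (setupAt S k) a msq).Qks j *ᵥ fun w => g ((eSiteAt S hk hj).symm w) i) (eSiteAt S hk (Nat.zero_le _) x) := by
  rw [Qks_mulVec a msq (le_range_at S k hj), ← eSiteAt_blockIter S hk hj, Equiv.symm_apply_apply]
  simp [avgQkAdj, zeroCharge_U]

/-- **`P_j = Q_j^*Q_j` at zero field IS `Setup`'s `Q^*_jQ_j`** on the level-`k` torus (`j ≦ k`), componentwise.
[cite: Balaban1982Higgs1, (2.20) p.610] -/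
theorem projPk_zero_apply_at (a msq : ℝ) {j : ℕ} (hj : j ≤ k) (φ : HiggsLattice.ScalarField P 0 N)
    (x : HiggsLattice.Site P 0) (i : Fin N) :
    (projPk (zeroCharge N) (0 : HiggsLattice.VecField P 0) j φ x) i
      = (((tower (setupAt S k) a msq).Qks j * (tower (setupAt S k) a msq).Qk j) *ᵥ cmpAt S hk i φ)
          (eSiteAt S hk (Nat.zero_le _) x) := by
  rw [← Matrix.mulVec_mulVec, projPk, LinearMap.comp_apply, avgQkAdj_zero_apply_at S hk a msq hj]
  congr 2
  funext w
  rw [← Equiv.apply_symm_apply (eSiteAt S hk hj) w, avgQkLin_zero_apply_at S hk a msq hj, Equiv.symm_apply_apply,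
    Equiv.apply_symm_apply]

/-- `hOp_mulVec_apply` on the level-`k` torus of a shape, the direction sum indexed by the model's `Fin d`. [cite: Balaban1982Higgs1, (1.11) p.605] -/
theorem hOp_setupAt_mulVec_apply (s msq : ℝ) (f : Site (setupAt S k) 0 → ℝ) (z : Site (setupAt S k) 0) :
    (hOp (setupAt S k) 0 s msq *ᵥ f) z
      = msq * f z + (s⁻¹) ^ 2 * ∑ μ : Fin P.d, ((f z - f (z.shift μ)) + (f z - f (z.unshift μ))) :=
  hOp_mulVec_apply s msq f z

/-- **THE OPERATOR OF (2.20) AT ZERO FIELD, LEVEL `k ≦ K`, READ ON THE LEVEL-`k` TORUS**: the `i`-th component of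
`(−Δ^ε + m² + a_k(L^kε)^{−2}P_k)φ` at `x` equals `ℓ^{−2}·((H_S(m²ℓ²) + a_k·Q^*_kQ_k) cmp_i φ)(e x)`, `ℓ = L^kε`, where
`H_S(m²ℓ²) = −Δ^{η} + m²ℓ²`, `η = L^{−k}`, and `α_k = a_k` are the top-level data of the torus tower `B1RG242Torus.tower (setupAt S k) a (m²ℓ²)`
— (2.20) = (2.22)·`ℓ^{−2}` on the unit lattice `T^{(k)}`. [cite: Balaban1982Higgs1, (2.20) p.610; (2.22) p.610] -/
theorem covOpK_zero_apply_at (msq a : ℝ) (φ : HiggsLattice.ScalarField P 0 N) (x : HiggsLattice.Site P 0) (i : Fin N) :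
    (covOpK (zeroCharge N) Finset.univ (0 : HiggsLattice.VecField P 0) msq a k φ x) i
      = (P.mesh k ^ 2)⁻¹ *
          ((H (setupAt S k) (msq * P.mesh k ^ 2)
              + α (setupAt S k) a k • (Qks (setupAt S k) k * Qk (setupAt S k) k))
            *ᵥ cmpAt S hk i φ) (eSiteAt S hk (Nat.zero_le _) x) := by
  have hℓ : P.mesh k ≠ 0 := (P.mesh_pos k).ne'
  have hℓ2 : P.mesh k ^ 2 ≠ 0 := pow_ne_zero 2 hℓ
  -- the left side, term by term
  have hL : (covOpK (zeroCharge N) Finset.univ (0 : HiggsLattice.VecField P 0) msq a k φ x) i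
      = (covLaplacianN (zeroCharge N) Finset.univ (0 : HiggsLattice.VecField P 0) φ x) i + msq * φ x i
        + B1.aSeq a P.L k * ((P.mesh k)⁻¹ ^ 2)
            * (projPk (zeroCharge N) (0 : HiggsLattice.VecField P 0) k φ x) i := by
    simp only [covOpK, LinearMap.add_apply, LinearMap.smul_apply, LinearMap.id_apply, Pi.add_apply, Pi.smul_apply,
      PiLp.add_apply, PiLp.smul_apply, smul_eq_mul]
  -- the right side, term by term
  have hR : ((H (setupAt S k) (msq * P.mesh k ^ 2)
        + α (setupAt S k) a k • (Qks (setupAt S k) k * Qk (setupAt S k) k)) *ᵥ cmpAt S hk i φ)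
          (eSiteAt S hk (Nat.zero_le _) x)
      = (hOp (setupAt S k) 0 (setupAt S k).eps (msq * P.mesh k ^ 2) *ᵥ cmpAt S hk i φ) (eSiteAt S hk (Nat.zero_le _) x)
        + α (setupAt S k) a k
            * (((tower (setupAt S k) a msq).Qks k * (tower (setupAt S k) a msq).Qk k) *ᵥ cmpAt S hk i φ)
                (eSiteAt S hk (Nat.zero_le _) x) := by
    rw [Matrix.add_mulVec, Matrix.smul_mulVec, Pi.add_apply, Pi.smul_apply, smul_eq_mul]
    rfl
  have hα : α (setupAt S k) a k = B1.aSeq a P.L k := by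
    show B1.aSeq a (setupAt S k).L k * ((setupAt S k).spacing k ^ 2)⁻¹ = _
    rw [spacing_top, one_pow, inv_one, mul_one, setupAt_L]
  have hε : (P.mesh 0)⁻¹ ^ 2 = (P.mesh k ^ 2)⁻¹ * ((setupAt S k).eps⁻¹) ^ 2 := by
    rw [mesh_zero_eq_at S k, mul_inv, mul_pow, inv_pow]
  rw [hL, hR, covLaplacianN_zero_apply_at S hk, hOp_setupAt_mulVec_apply, ← projPk_zero_apply_at S hk a msq le_rfl, hα, hε,
    cmpAt_apply_eSiteAt]
  field_simp
  ring

/-- The same dictionary as an identity of functions on the level-`k` torus, for EVERY coupling `C` (§3):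
`cmp_i((2.20)-operator φ) = ℓ^{−2}·(H_S + a_kQ^*_kQ_k)cmp_iφ`. [cite: Balaban1982Higgs1, (2.20) p.610] -/
theorem cmpAt_covOpK (C : ChargeData N) (msq a : ℝ) (φ : HiggsLattice.ScalarField P 0 N) (i : Fin N) :
    cmpAt S hk i (covOpK C Finset.univ (0 : HiggsLattice.VecField P 0) msq a k φ)
      = (P.mesh k ^ 2)⁻¹ •
          ((H (setupAt S k) (msq * P.mesh k ^ 2)
              + α (setupAt S k) a k • (Qks (setupAt S k) k * Qk (setupAt S k) k))
            *ᵥ cmpAt S hk i φ) := by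
  funext z
  rw [covOpK_charge_zeroField, Pi.smul_apply, smul_eq_mul, ← Equiv.apply_symm_apply (eSiteAt S hk (Nat.zero_le _)) z,
    cmpAt_apply_eSiteAt, covOpK_zero_apply_at S hk, Equiv.apply_symm_apply]

end Dictionary

/-! ## §5 (2.20) at zero field, level `k`, is `(L^kε)²·G_k` of the level-`k` torus tower: a genuine two-sided inverse -/

section Propagator

variable (S : Shape P) {k : ℕ} (hk : k ≤ P.K) {N : ℕ} (C : ChargeData N) {msq a : ℝ}

/-- **Right inverse**: `(−Δ^ε + m² + a_k(L^kε)^{−2}P_k)·(ℓ²·lift G_k) = 1`, `G_k` the top propagator of the level-`k` torus tower at mass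
`m²ℓ²`, `ℓ = L^kε` (`1 ≦ k`, `a > 0`, `m² ≧ 0`). [cite: Balaban1982Higgs1, (2.20) p.610; (2.22) p.610] -/
theorem covOpK_mul_liftAt (hk1 : 1 ≤ k) (ha : 0 < a) (hmsq : 0 ≤ msq) :
    covOpK C Finset.univ (0 : HiggsLattice.VecField P 0) msq a k
        * ((P.mesh k ^ 2) • liftAt S hk (N := N) ((tower (setupAt S k) a (msq * P.mesh k ^ 2)).G k)) = 1 := by
  have hℓ2 : P.mesh k ^ 2 ≠ 0 := pow_ne_zero 2 (P.mesh_pos k).ne'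
  have hm : 0 ≤ msq * P.mesh k ^ 2 := mul_nonneg hmsq (sq_nonneg _)
  refine LinearMap.ext fun φ => eq_of_cmpAt_eq S hk fun i => ?_
  rw [Module.End.mul_apply, Module.End.one_apply, cmpAt_covOpK S hk, LinearMap.smul_apply, map_smul, cmpAt_liftAt,
    Matrix.mulVec_smul, smul_smul, inv_mul_cancel₀ hℓ2, one_smul, Matrix.mulVec_mulVec,
    opS_mul_G (setupAt S k) ha hm hk1, Matrix.one_mulVec]

/-- **Left inverse**: `(ℓ²·lift G_k)·(−Δ^ε + m² + a_k(L^kε)^{−2}P_k) = 1`. [cite: Balaban1982Higgs1, (2.20) p.610; (2.22) p.610] -/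
theorem liftAt_mul_covOpK (hk1 : 1 ≤ k) (ha : 0 < a) (hmsq : 0 ≤ msq) :
    ((P.mesh k ^ 2) • liftAt S hk (N := N) ((tower (setupAt S k) a (msq * P.mesh k ^ 2)).G k))
        * covOpK C Finset.univ (0 : HiggsLattice.VecField P 0) msq a k = 1 := by
  have hℓ2 : P.mesh k ^ 2 ≠ 0 := pow_ne_zero 2 (P.mesh_pos k).ne'
  have hm : 0 ≤ msq * P.mesh k ^ 2 := mul_nonneg hmsq (sq_nonneg _)
  refine LinearMap.ext fun φ => eq_of_cmpAt_eq S hk fun i => ?_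
  rw [Module.End.mul_apply, Module.End.one_apply, LinearMap.smul_apply, map_smul, cmpAt_liftAt, cmpAt_covOpK S hk,
    Matrix.mulVec_smul, smul_smul, mul_inv_cancel₀ hℓ2, one_smul, Matrix.mulVec_mulVec,
    G_mul_opS (setupAt S k) ha hm hk1, Matrix.one_mulVec]

/-- **The operator of (2.20) at zero field is invertible on the model's carrier**, every coupling, every `N`, levels `1 ≦ k ≦ K`
(`a > 0`, `m² ≧ 0`; torus sub-family). [cite: Balaban1982Higgs1, (2.20) p.610] -/
theorem isUnit_covOpK_zero_at (S₀ : Shape P) (hk₀ : k ≤ P.K) (hk1 : 1 ≤ k) (ha : 0 < a) (hmsq : 0 ≤ msq) :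
    IsUnit (covOpK C Finset.univ (0 : HiggsLattice.VecField P 0) msq a k) :=
  ⟨⟨_, _, covOpK_mul_liftAt S₀ hk₀ C hk1 ha hmsq, liftAt_mul_covOpK S₀ hk₀ C hk1 ha hmsq⟩, rfl⟩

/-- **(2.20) AT ZERO FIELD, LEVEL `k` = `(L^kε)²·`(2.22) OF THE LEVEL-`k` TORUS TOWER**, for every coupling `C` and every `N`:
`G^ε_k(T_ε, 0) = propagatorK C T_ε 0 m² a k` (a `Ring.inverse`) IS `ℓ²·lift((B1RG242Torus.tower (setupAt S k) a (m²ℓ²)).G k)`, `ℓ = L^kε`,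
`1 ≦ k ≦ K`. [cite: Balaban1982Higgs1, (2.20) p.610; (2.22) p.610] -/
theorem propagatorK_zero_eq_at (hk1 : 1 ≤ k) (ha : 0 < a) (hmsq : 0 ≤ msq) :
    propagatorK C Finset.univ (0 : HiggsLattice.VecField P 0) msq a k
      = (P.mesh k ^ 2) • liftAt S hk (N := N) ((tower (setupAt S k) a (msq * P.mesh k ^ 2)).G k) := by
  let u : (Module.End ℝ (HiggsLattice.ScalarField P 0 N))ˣ :=
    ⟨_, _, covOpK_mul_liftAt S hk C hk1 ha hmsq, liftAt_mul_covOpK S hk C hk1 ha hmsq⟩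
  show Ring.inverse (u : Module.End ℝ (HiggsLattice.ScalarField P 0 N)) = _
  rw [Ring.inverse_unit]
  rfl

/-- **Pointwise**: `(G^ε_k(T_ε,0)g)(x)_i = (L^kε)²·(G_k cmp_i g)(e x)`, every coupling, `1 ≦ k ≦ K`. [cite: Balaban1982Higgs1, (2.20) p.610; (2.22) p.610] -/
theorem propagatorK_zero_apply_at (hk1 : 1 ≤ k) (ha : 0 < a) (hmsq : 0 ≤ msq) (g : HiggsLattice.ScalarField P 0 N)
    (x : HiggsLattice.Site P 0) (i : Fin N) :
    (propagatorK C Finset.univ (0 : HiggsLattice.VecField P 0) msq a k g x) i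
      = P.mesh k ^ 2 * ((tower (setupAt S k) a (msq * P.mesh k ^ 2)).G k *ᵥ cmpAt S hk i g) (eSiteAt S hk (Nat.zero_le _) x) := by
  rw [propagatorK_zero_eq_at S hk C hk1 ha hmsq, LinearMap.smul_apply, Pi.smul_apply, PiLp.smul_apply, smul_eq_mul, liftAt_apply]

/-- The components of `G^ε_k(T_ε,0)g` on the level-`k` torus: `cmp_i(G^ε_kg) = ℓ²·G_k cmp_ig`. [cite: Balaban1982Higgs1, (2.20) p.610; (2.22) p.610] -/
theorem cmpAt_propagatorK (hk1 : 1 ≤ k) (ha : 0 < a) (hmsq : 0 ≤ msq) (g : HiggsLattice.ScalarField P 0 N) (i : Fin N) :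
    cmpAt S hk i (propagatorK C Finset.univ (0 : HiggsLattice.VecField P 0) msq a k g)
      = (P.mesh k ^ 2) • ((tower (setupAt S k) a (msq * P.mesh k ^ 2)).G k *ᵥ cmpAt S hk i g) := by
  rw [propagatorK_zero_eq_at S hk C hk1 ha hmsq, LinearMap.smul_apply, map_smul, cmpAt_liftAt]

end Propagator

/-! ## §6 The torus distance (1.3) of the model IS the sup torus distance of the `Setup` lineage -/

section Distance

variable (S : Shape P) {k : ℕ} (hk : k ≤ P.K)

/-- **(1.3) under the identification**: `B5Ineq137Torus.T (setupAt S k) j (e x) (e z)` — the sup circular distance of the `Setup`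
lineage, in lattice units of `T^{(j)}` — IS the printed torus distance (1.3) *"|x − y| = max_μ min{|x_μ − y_μ|, 2L_μ − |x_μ − y_μ|}"* in
lattice units (`HiggsLattice.Site.tdist`), `j ≦ k ≦ K`. [cite: Balaban1982Higgs1, (1.3) p.604] -/
theorem T_eSiteAt {j : ℕ} (hj : j ≤ k) (x z : HiggsLattice.Site P j) :
    T (setupAt S k) j (eSiteAt S hk hj x) (eSiteAt S hk hj z) = (HiggsLattice.Site.tdist x z : ℝ) := by
  unfold T B4Sect5Torus.tdist HiggsLattice.Site.tdist
  congr 2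
  funext μ
  simp only [B4Sect5Torus.ccoord, B5Ineq137Torus.toT, val_eSiteAt]
  have hN : B5Ineq137Torus.Nv (setupAt S k) j μ = P.sitesPerDir j μ := (sitesPerDir_eq_at S hk hj μ).symm
  rw [hN]
  exact circAbs_val_sub (x μ) (z μ)

/-- The distance dictionary read from the `Setup` side: `T (setupAt S k) j w w′ = tdist (e⁻¹w) (e⁻¹w′)`. [cite: Balaban1982Higgs1, (1.3) p.604] -/
theorem T_eq_tdist_symm {j : ℕ} (hj : j ≤ k) (w w' : Site (setupAt S k) j) :
    T (setupAt S k) j w w' = (HiggsLattice.Site.tdist ((eSiteAt S hk hj).symm w) ((eSiteAt S hk hj).symm w') : ℝ) := by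
  rw [← T_eSiteAt S hk hj, Equiv.apply_symm_apply, Equiv.apply_symm_apply]

end Distance

end Literature.MathematicalPhysics.QuantumFieldTheory.Balaban1983to89.B1Eq220ZeroFieldTorusLevels
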